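import Mathlib
import Literature.NumberTheory.LFunctions.Zhang2022.RepairAdmissible
import HarnessLib

/-!
# Zhang (2022), rescue gap table (D-0124 (4)) III: the printed ν-box — kernel twin of the quantifier's LP-2

Topic `Literature/NumberTheory/LFunctions/Zhang2022` (Landau–Siegel audit tree; verdict-neutral).
Y. Zhang, *Discrete mean estimates and the Landau–Siegel zero*, arXiv:2211.02515v1 (2022)
[Zhang2022LandauSiegel] — **an unrefereed manuscript under adjudication; nothing in this file asserts or
denies its Theorems 1–2, and nothing here is a claim about Landau–Siegel zeros.**

The LS-rescue gap table's Part B («the printed design box», EXPONENT currency) is the polytope of the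
quantifier's kit LP-2 (job j271436, `LP2.json`): the side conditions of the manuscript that constrain the
mollifier exponents `(ν₁, ν₂, ν₃)` of (2.21) and the cut `cut₁` of (12.1), read in the `τ_T = log T/log P → 0`
limit — B1 `ν_j ≤ 1` ((7.2)), B2 `2ν₂ ≤ 1` ((14.2)/(15.2)), B3 `cut₁ + ν₂ ≤ 1`, `cut₁ ≤ ν₁`, `0 ≤ cut₁`
((12.12)–(12.13), (B.3)), B4 `1 ≤ ν₁ + ν₂` (Lemma 12.3), B5 `1 ≤ ν₁ + ν₃` ((12.13)), B6 `ν₃ ≤ ν₂` ((2.21)),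
positivity. The kit certified (exact rationals): the slacks at the printed point `θ₀ = (0.504, ½, 0.498, ½)`
(B2 and B3a SATURATED; 0.002 at B5/B6; 0.004 at B3b/B4), eight vertices of the closed slab, the
max-min-slack («unnormalised Chebyshev») centre `(6/7, 3/7, 2/7, 3/7)` with common slack `1/7`, and the
single-axis ranges from `θ₀`. This file is the KERNEL TWIN of those statements (as `RepairGapCurrencies`
is for LP-1 and `RepairGapExponentBudget` for LP-3), and adds the one structural fact the table uses
implicitly («feasible set = R, the LP-2 slab × twists/ι/profiles», GAP-TABLE G-05): on the printed cut
`cut₁ = ½` the quantifier's slab IS the `ν`-part of the tree's admissible class `Repair.AdmissibleTheta`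
(`RepairAdmissible.lean`) — `admissibleTheta_iff_nuSlabPrinted` — so the two independent readings of the
printed side conditions (the quantifier's PARAMS §7 and the class `R` of the kernel verdict
`Repair.not_repairable_true_need`) agree.

* `NuSlab` (closed slab, all twelve rows of `LP2.json` with `≤`), `NuSlabPrinted` (strict where print is
  strict), `NuSlabPrinted.toSlab`;
* `nuSlabPrinted_of_admissible`, `admissibleTheta_iff_nuSlabPrinted` (R = printed slab ∩ {cut₁ = ½} × k-box);
* `nuSlab_theta0_slacks` (the twelve slacks at `θ₀`; B2/B3a saturated), `nuSlabPrinted_theta0`;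
* `nuSlab_vertices` (the eight kit vertices are members of the closed slab — that they are ALL the vertices
  is the kit's enumeration, not restated), `CommonSlack`, `commonSlack_center`, `commonSlack_le`
  (Farkas certificate `2·(B1a + B5 + B6) + B2`: every common slack is `≤ 1/7`), `commonSlack_isGreatest`;
* `nuSlab_axis_nu1/nu2/nu3/cut1` (single-axis ranges from `θ₀` as `iff`s).

Pure linear arithmetic over `ℝ` about a polytope; the numbers are the manuscript's printed exponents and the
quantifier's reading of its side conditions (locators per row below, = those of `RepairAdmissible`). No
statement about `L`-functions; no facts, no axioms beyond the standard three. Drafted from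
rescue/ls-rescue-quant-1/lp/j271436/LP2.json + REPORT.md (ls-rescue-quant-1 g0).

## References

* Y. Zhang, arXiv:2211.02515v1 (2022), §2 (2.21), §7 (7.2), §12 (12.1), (12.12)–(12.13), Lemma 12.3,
  §14 (14.2), §15 (15.2), Appendix B (B.3). [cite: Zhang2022LandauSiegel, §§2, 7, 12, 14, 15, App. B]
-/

noncomputable section

namespace Literature.NumberTheory.LFunctions.Zhang2022.Repair.Gap

/-! ## The slab -/

/-- **LP-2's CLOSED slab** in `(ν₁, ν₂, ν₃, cut₁)` (the twelve rows of `LP2.json`, `τ → 0` limit, all closed):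
B1a–c `ν_j ≤ 1` · B2 `2ν₂ ≤ 1` · B3a `cut₁ + ν₂ ≤ 1` · B3b `cut₁ ≤ ν₁` · B3c `0 ≤ cut₁` · B4 `1 ≤ ν₁ + ν₂` ·
B5 `1 ≤ ν₁ + ν₃` · B6 `ν₃ ≤ ν₂` · P1 `0 ≤ ν₁` · P3 `0 ≤ ν₃`. A predicate on four reals; nothing is asserted.
[cite: Zhang2022LandauSiegel, §7 (7.2); §14 (14.2); §12 (12.12)–(12.13), Lemma 12.3; §2 (2.21)] -/
def NuSlab (ν₁ ν₂ ν₃ c : ℝ) : Prop :=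
  ν₁ ≤ 1 ∧ ν₂ ≤ 1 ∧ ν₃ ≤ 1 ∧ 2 * ν₂ ≤ 1 ∧ c + ν₂ ≤ 1 ∧ c ≤ ν₁ ∧ 0 ≤ c ∧ 1 ≤ ν₁ + ν₂ ∧ 1 ≤ ν₁ + ν₃ ∧
    ν₃ ≤ ν₂ ∧ 0 ≤ ν₁ ∧ 0 ≤ ν₃

/-- **LP-2's slab AS PRINTED** (strict where the manuscript's side condition is strict, `LP2.json`
`strict_in_print`): B1 `ν_j < 1` ((7.2) «`a(n) = 0` for `n ≥ PT⁻²`»), B2 `2ν₂ ≤ 1` (the `T⁻¹⁰` of `P₂` points the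
right way), B3a `cut₁ + ν₂ ≤ 1`, B3b `cut₁ < ν₁` ((B.3)), B3c `0 < cut₁`, B4 `1 < ν₁ + ν₂` (Lemma 12.3), B5
`1 < ν₁ + ν₃` ((12.13)), B6 `ν₃ < ν₂` ((2.21)), P1/P3 `0 < ν₁`, `0 < ν₃`.
[cite: Zhang2022LandauSiegel, §7 (7.2); §14 (14.2); §12 (12.12)–(12.13), Lemma 12.3; §2 (2.21); App. B (B.3)] -/
def NuSlabPrinted (ν₁ ν₂ ν₃ c : ℝ) : Prop :=
  ν₁ < 1 ∧ ν₂ < 1 ∧ ν₃ < 1 ∧ 2 * ν₂ ≤ 1 ∧ c + ν₂ ≤ 1 ∧ c < ν₁ ∧ 0 < c ∧ 1 < ν₁ + ν₂ ∧ 1 < ν₁ + ν₃ ∧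
    ν₃ < ν₂ ∧ 0 < ν₁ ∧ 0 < ν₃

/-- The printed slab lies in the closed slab. [cite: Zhang2022LandauSiegel, §2 (2.21); §7 (7.2)] -/
theorem NuSlabPrinted.toSlab {ν₁ ν₂ ν₃ c : ℝ} (h : NuSlabPrinted ν₁ ν₂ ν₃ c) : NuSlab ν₁ ν₂ ν₃ c := by
  obtain ⟨h1, h2, h3, h4, h5, h6, h7, h8, h9, h10, h11, h12⟩ := h
  exact ⟨h1.le, h2.le, h3.le, h4, h5, h6.le, h7.le, h8.le, h9.le, h10.le, h11.le, h12.le⟩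

/-! ## The slab and the admissible class `R` -/

/-- **`R ⊆` printed slab**: the `ν`/cut coordinates of every admissible `θ` (`Repair.AdmissibleTheta`, the class
of the kernel verdict) satisfy LP-2's printed system. [cite: Zhang2022LandauSiegel, §2 (2.21); §7 (7.2); §12 (12.1)] -/
theorem nuSlabPrinted_of_admissible {θ : Theta} (h : AdmissibleTheta θ) :
    NuSlabPrinted θ.nu1 θ.nu2 θ.nu3 θ.cut1 := by
  obtain ⟨⟨h32, h21⟩, ⟨h3, h2, h1⟩, hP, hd, hc, -, -⟩ := h
  unfold Theta.belowP at hP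
  unfold Theta.dualRangesNonempty at hd
  unfold Theta.cutAtHalf at hc
  unfold NuSlabPrinted
  rw [hc]
  refine ⟨hP, ?_, ?_, ?_, ?_, h1, ?_, ?_, hd, h32, ?_, ?_⟩ <;> linarith

/-- **`R` = printed slab ∩ {`cut₁ = ½`} × the `k`-box**: on the printed cut the quantifier's LP-2 system and the
`ν`-conjuncts of `Repair.AdmissibleTheta` (`orderedLengths`, `straddleHalf`, `belowP`, `dualRangesNonempty`) are
the SAME region — the two independent readings of the printed side conditions agree.
[cite: Zhang2022LandauSiegel, §2 (2.21); §7 (7.2); §12 (12.1), (12.12)–(12.13)] -/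
theorem admissibleTheta_iff_nuSlabPrinted (θ : Theta) :
    AdmissibleTheta θ ↔
      NuSlabPrinted θ.nu1 θ.nu2 θ.nu3 θ.cut1 ∧ θ.cutAtHalf ∧ θ.shiftsInContour ∧ θ.tiedOuterShifts := by
  constructor
  · intro h
    exact ⟨nuSlabPrinted_of_admissible h, h.2.2.2.2.1, h.2.2.2.2.2.1, h.2.2.2.2.2.2⟩
  · rintro ⟨hS, hc, hk, ht⟩
    obtain ⟨h1, -, -, h4, -, h6, -, -, h9, h10, -, -⟩ := hS
    have hc' : θ.cut1 = 1 / 2 := hc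
    rw [hc'] at h6
    refine ⟨⟨h10, by linarith⟩, ⟨by linarith, by linarith, h6⟩, h1, h9, hc, hk, ht⟩

/-! ## The printed point: slacks (LP-2 `slacks_at_theta0`) -/

/-- **The twelve slacks at `θ₀ = (0.504, ½, 0.498, ½)`** (LP-2, exact): B1a `0.496` · B1b `0.5` · B1c `0.502` ·
**B2 `0` (SATURATED)** · **B3a `0` (SATURATED)** · B3b `0.004` · B3c `0.5` · B4 `0.004` · B5 `0.002` · B6 `0.002` ·
P1 `0.504` · P3 `0.498` (B3b/B4/B5/B6 are `Theta.win/L7/L6/s23` of `RepairTheta`: `theta0_win`, `theta0_L7`,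
`theta0_L6`, `theta0_s23`). [cite: Zhang2022LandauSiegel, §2 (2.21); §12 (12.1)] -/
theorem nuSlab_theta0_slacks :
    1 - theta0.nu1 = 0.496 ∧ 1 - theta0.nu2 = 0.5 ∧ 1 - theta0.nu3 = 0.502 ∧ 1 - 2 * theta0.nu2 = 0 ∧
      1 - (theta0.cut1 + theta0.nu2) = 0 ∧ theta0.nu1 - theta0.cut1 = 0.004 ∧ theta0.cut1 = 0.5 ∧
      theta0.nu1 + theta0.nu2 - 1 = 0.004 ∧ theta0.nu1 + theta0.nu3 - 1 = 0.002 ∧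
      theta0.nu2 - theta0.nu3 = 0.002 ∧ theta0.nu1 = 0.504 ∧ theta0.nu3 = 0.498 := by
  unfold theta0
  norm_num

/-- `θ₀` lies in the printed slab (via `admissible_theta0`). [cite: Zhang2022LandauSiegel, §2 (2.21); §12 (12.1)] -/
theorem nuSlabPrinted_theta0 : NuSlabPrinted theta0.nu1 theta0.nu2 theta0.nu3 theta0.cut1 :=
  nuSlabPrinted_of_admissible admissible_theta0

/-! ## Vertices and the max-min-slack centre (LP-2 `vertices`, `max_min_slack_point`) -/

/-- **The eight kit vertices are members of the closed slab**: `(½,½,½,0)`, `(½,½,½,½)`, `(1,0,0,0)`, `(1,0,0,1)`,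
`(1,½,0,0)`, `(1,½,0,½)`, `(1,½,½,0)`, `(1,½,½,½)` (that these are ALL the vertices is the kit's enumeration,
LP-2 j271436, not restated here). [cite: Zhang2022LandauSiegel, §2 (2.21); §12 (12.1)] -/
theorem nuSlab_vertices :
    NuSlab (1 / 2) (1 / 2) (1 / 2) 0 ∧ NuSlab (1 / 2) (1 / 2) (1 / 2) (1 / 2) ∧ NuSlab 1 0 0 0 ∧
      NuSlab 1 0 0 1 ∧ NuSlab 1 (1 / 2) 0 0 ∧ NuSlab 1 (1 / 2) 0 (1 / 2) ∧ NuSlab 1 (1 / 2) (1 / 2) 0 ∧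
      NuSlab 1 (1 / 2) (1 / 2) (1 / 2) := by
  unfold NuSlab
  norm_num

/-- **A common lower bound `t` for all twelve raw slacks** at `(ν₁, ν₂, ν₃, cut₁)` (the LP whose optimum is the
«unnormalised Chebyshev centre» of LP-2). [cite: Zhang2022LandauSiegel, §2 (2.21); §12 (12.1)] -/
def CommonSlack (ν₁ ν₂ ν₃ c t : ℝ) : Prop :=
  t ≤ 1 - ν₁ ∧ t ≤ 1 - ν₂ ∧ t ≤ 1 - ν₃ ∧ t ≤ 1 - 2 * ν₂ ∧ t ≤ 1 - (c + ν₂) ∧ t ≤ ν₁ - c ∧ t ≤ c ∧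
    t ≤ ν₁ + ν₂ - 1 ∧ t ≤ ν₁ + ν₃ - 1 ∧ t ≤ ν₂ - ν₃ ∧ t ≤ ν₁ ∧ t ≤ ν₃

/-- **The kit's centre `(6/7, 3/7, 2/7, 3/7)` has common slack `1/7`** (tight rows B1a, B2, B3a, B5, B6).
[cite: Zhang2022LandauSiegel, §2 (2.21); §12 (12.1)] -/
theorem commonSlack_center : CommonSlack (6 / 7) (3 / 7) (2 / 7) (3 / 7) (1 / 7) := by
  unfold CommonSlack
  norm_num

/-- **No point does better — Farkas certificate `2·(B1a + B5 + B6) + B2`**: `t ≤ 1 − ν₁`, `t ≤ ν₁ + ν₃ − 1`,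
`t ≤ ν₂ − ν₃` give `3t ≤ ν₂`, and `t ≤ 1 − 2ν₂` then gives `7t ≤ 1`. So LP-2's max-min slack is EXACTLY `1/7`.
[cite: Zhang2022LandauSiegel, §2 (2.21); §12 (12.1)] -/
theorem commonSlack_le {ν₁ ν₂ ν₃ c t : ℝ} (h : CommonSlack ν₁ ν₂ ν₃ c t) : t ≤ 1 / 7 := by
  obtain ⟨h1, -, -, h4, -, -, -, -, h9, h10, -, -⟩ := h
  linarith

/-- **LP-2's max-min slack is `1/7`, attained at the kit's centre.** [cite: Zhang2022LandauSiegel, §2 (2.21); §12 (12.1)] -/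
theorem commonSlack_isGreatest :
    IsGreatest {t : ℝ | ∃ ν₁ ν₂ ν₃ c : ℝ, CommonSlack ν₁ ν₂ ν₃ c t} (1 / 7) :=
  ⟨⟨6 / 7, 3 / 7, 2 / 7, 3 / 7, commonSlack_center⟩, fun _ ⟨_, _, _, _, h⟩ => commonSlack_le h⟩

/-! ## Single-axis ranges from `θ₀` (LP-2 `axis_ranges_from_theta0`) -/

/-- **`ν₁`-axis through `θ₀`**: `ν₁ ∈ [0.502, 1]` (lower wall B5 `ν₁ + 0.498 ≥ 1`, upper wall B1a).
[cite: Zhang2022LandauSiegel, §2 (2.21); §7 (7.2); §12 (12.13)] -/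
theorem nuSlab_axis_nu1 (ν₁ : ℝ) : NuSlab ν₁ 0.5 0.498 0.5 ↔ 0.502 ≤ ν₁ ∧ ν₁ ≤ 1 := by
  unfold NuSlab
  constructor
  · rintro ⟨h1, -, -, -, -, -, -, -, h9, -, -, -⟩
    constructor <;> linarith
  · rintro ⟨ha, hb⟩
    refine ⟨hb, ?_, ?_, ?_, ?_, ?_, ?_, ?_, ?_, ?_, ?_, ?_⟩ <;> linarith

/-- **`ν₂`-axis through `θ₀`**: `ν₂ ∈ [0.498, 0.5]` (lower wall B6 `ν₃ ≤ ν₂`, upper walls B2/B3a).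
[cite: Zhang2022LandauSiegel, §2 (2.21); §14 (14.2)] -/
theorem nuSlab_axis_nu2 (ν₂ : ℝ) : NuSlab 0.504 ν₂ 0.498 0.5 ↔ 0.498 ≤ ν₂ ∧ ν₂ ≤ 0.5 := by
  unfold NuSlab
  constructor
  · rintro ⟨-, -, -, h4, -, -, -, -, -, h10, -, -⟩
    constructor <;> linarith
  · rintro ⟨ha, hb⟩
    refine ⟨?_, ?_, ?_, ?_, ?_, ?_, ?_, ?_, ?_, ha, ?_, ?_⟩ <;> linarith

/-- **`ν₃`-axis through `θ₀`**: `ν₃ ∈ [0.496, 0.5]` (lower wall B5, upper wall B6).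
[cite: Zhang2022LandauSiegel, §2 (2.21); §12 (12.13)] -/
theorem nuSlab_axis_nu3 (ν₃ : ℝ) : NuSlab 0.504 0.5 ν₃ 0.5 ↔ 0.496 ≤ ν₃ ∧ ν₃ ≤ 0.5 := by
  unfold NuSlab
  constructor
  · rintro ⟨-, -, -, -, -, -, -, -, h9, h10, -, -⟩
    constructor <;> linarith
  · rintro ⟨ha, hb⟩
    refine ⟨?_, ?_, ?_, ?_, ?_, ?_, ?_, ?_, ?_, hb, ?_, ?_⟩ <;> linarith

/-- **`cut₁`-axis through `θ₀`**: `cut₁ ∈ [0, 0.5]` in the closed slab (walls B3c, B3a; print has `0 < cut₁`).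
[cite: Zhang2022LandauSiegel, §12 (12.1), (12.12)–(12.13); App. B (B.3)] -/
theorem nuSlab_axis_cut1 (c : ℝ) : NuSlab 0.504 0.5 0.498 c ↔ 0 ≤ c ∧ c ≤ 0.5 := by
  unfold NuSlab
  constructor
  · rintro ⟨-, -, -, -, h5, -, h7, -, -, -, -, -⟩
    constructor <;> linarith
  · rintro ⟨ha, hb⟩
    refine ⟨?_, ?_, ?_, ?_, ?_, ?_, ha, ?_, ?_, ?_, ?_, ?_⟩ <;> linarith

end Literature.NumberTheory.LFunctions.Zhang2022.Repair.Gap
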